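import Summits.HodgeConjecture.HodgeConjecture.Theorems.F0P3cStCharTSShellOrbitalGCan       -- ★ (this seat) «OCAN-SHELL»: `cmDatumLocalCongr_one_apply`, the identity frame; brings ★ p849606 Stage B
import Summits.HodgeConjecture.HodgeConjecture.Theorems.F0P3cStCharTSShellTracePS          -- ★ F1-G (LH6): `smoothTrace_cmPrincipalSeries_indicator_shell_eq_ite`, `forall_cmTorusCharPair_eq_one_iff_of_weylConj_mem`
import Summits.HodgeConjecture.HodgeConjecture.Theorems.F0P2pTorusPairsAndVacuity          -- ★ `continuous_components_of_continuous_torusCharPair`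
import Literature.NumberTheory.Automorphic.UnitaryGroupRankOneTorusCharacters              -- ★ `exists_cmTorusCharPair_eq` (every torus character is a pair)
import HarnessLib

/-!
# F0 · P3c · line LH6 «StCharTS» — road (D), brick D3-ii «HF1-SHELL»: the hypothesis `hF1` of ★ p849606 `normalizedOrbitalIntegral_eq_twoCoset` for the shell
# indicator `𝟙_{K_n b K_n}` at the identity frame, from ★ F1-G `smoothTrace_cmPrincipalSeries_indicator_shell_eq_ite`

Cell `pub/hodgecm-mathlib`, crux H413 = `stmt-HodgeConjecture-24833` (lane `--supports … --as helper`); seat LH2-p03 (g3); road (D) owner LH6-p03 (g0) ∕ LH6-p04 (g3),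
dealer F0P3b-plan (g23).  THEOREMS ONLY, sorry-free, ★-only imports.  HONEST LABEL: HC_CM is proved only modulo the 7 printed citations (2 remaining: hLiu418 =
stmt-HodgeConjecture-24832, h413 = stmt-HodgeConjecture-24833) until rung 0 closes; count-neutral.

THE MATHEMATICS ([Rogawski1990, §12.2 pp. 173–174; §12.7 p. 193; §4.9 (4.9.4) p. 56]).  ★ F1-G computes, for CONTINUOUS `χ₁, χ₂`,
`tr i_G(χ₁,χ₂)(𝟙_{K_n b K_n}; μ) = μ(K_n)·#R·(if χ|_{K_n∩T} = 1 then δ_B^{1/2}(b)(χ(b) + (wχ)(b)) else 0)`.  Stage B (★ p849606) wants this for EVERY continuous character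
`χ` of `T` in the shape `if (∀ c ∈ C, χ c = 1) then A(χ(b₁) + κχ(b₂)) else 0` with the measure `ν_G ∘ e⁻¹` and the test function `f ∘ e`.  At the identity frame `e₁`
(`e₁ g = g`, ★ `cmDatumLocalCongr_one_apply`): every `χ` is a pair (★ `exists_cmTorusCharPair_eq`) with continuous components (★ `continuous_components_of_continuous_torusCharPair`);
`(wχ)(b) = χ(ʷb)` (★ `cmTorusCharPair_weylConj`); the `hiff` side condition holds when `w₀` normalises `K_n` (★ `forall_cmTorusCharPair_eq_one_iff_of_weylConj_mem`).  Result: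
`hF1` with `C := K_n ∩ T` (as `(𝓘.K n).comap T.subtype`), `b₁ := b`, `b₂ := ʷb = w₀ b w₀⁻¹`, `A := (ν_G∘e₁⁻¹)(K_n)·#R·δ_B^{1/2}(b)`, `κ := 1`.

## References
* [Rogawski1990] J. D. Rogawski, *Automorphic Representations of Unitary Groups in Three Variables*, Ann. of Math. Stud. 123 (1990), §12.2 pp. 173–174; §12.7 p. 193; §4.9 p. 56.
* [Casselman1995] W. Casselman, *Introduction to the theory of admissible representations of p-adic reductive groups* (1995 notes), Lemma 7.1.1 (a) p. 67, Thm. 3.3.3.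
-/

set_option autoImplicit false
set_option linter.dupNamespace false

noncomputable section

open NumberField IsDedekindDomain MeasureTheory Topology Filter Set Subgroup
open scoped Matrix MatrixGroups NNReal Pointwise
open Literature.MeasureTheory.Group Literature.NumberTheory Literature.NumberTheory.Automorphic Literature.NumberTheory.Automorphic.UnitaryGroup
open Literature.NumberTheory.Rogawski1990

namespace Summit.HodgeConjecture.HodgeConjecture.Cruxes.H413.F0P3cStCharTSShellOrbitalG

variable (L : Type) [Field L] [NumberField L] [IsCMField L]

open scoped Classical in
set_option maxHeartbeats 3200000 in
set_option synthInstance.maxHeartbeats 400000 in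
/-- **«HF1-SHELL»: the hypothesis `hF1` of ★ p849606 for `f = 𝟙_{K_n b K_n}` at the identity frame.**  Data: all places over `v` non-split (`hns`), a Haar measure `ν_G` on
`U(Φ₃)(L⁺_v)`, an Iwahori datum `𝓘`, a level `n`, a Weyl representative `w₀` (matrix `Φ₃`) normalising `K_n`, a torus element `b` dominant at level `n` (`hbN, hbNbar, hbexh`,
the letters of ★ F1-G) and a left transversal `R`.  Conclusion: for EVERY continuous character `χ` of `T`,
`tr i_G(χ)(𝟙_{K_nbK_n} ∘ e₁; ν_G ∘ e₁⁻¹) = if χ|_{K_n ∩ T} = 1 then A·(χ(b) + 1·χ(ʷb)) else 0`, `A = (ν_G∘e₁⁻¹)(K_n)·#R·δ_B^{1/2}(b)`.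
[cite: Rogawski1990, §12.2 pp. 173–174; §12.7 p. 193] [cite: Casselman1995, Lemma 7.1.1 (a) p. 67] -/
theorem hF1_indicator_shell {v : HeightOneSpectrum (𝓞 ↥(maximalRealSubfield L))} (hns : ∀ w : PlacesOver L v, IsCMField.complexConj L • w.1 = w.1)
    [MeasurableSpace ((cmDatum L 3 (qsForm L)).Local v)] [BorelSpace ((cmDatum L 3 (qsForm L)).Local v)]
    (νG : Measure ((cmDatum L 3 (qsForm L)).Local v)) [νG.IsHaarMeasure]
    [MeasurableSpace ↥(unitaryGroupOfForm (conjLocal L (IsCMField.complexConj L) v) (cmLocalForm L 3 v))] [BorelSpace ↥(unitaryGroupOfForm (conjLocal L (IsCMField.complexConj L) v) (cmLocalForm L 3 v))]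
    (𝓘 : (cmBorelTriple L 3 v).IwahoriDatum) (n : ℕ)
    (w₀ : ↥(unitaryGroupOfForm (conjLocal L (IsCMField.complexConj L) v) (cmLocalForm L 3 v))) (hw₀ : Units.val (w₀ : GL (Fin 3) (LocalRing L v)) = cmLocalForm L 3 v) (hKw : ∀ κ ∈ 𝓘.K n, w₀ * κ * w₀⁻¹ ∈ 𝓘.K n)
    {b : ↥(unitaryGroupOfForm (conjLocal L (IsCMField.complexConj L) v) (cmLocalForm L 3 v))} (hbM : b ∈ (cmBorelTriple L 3 v).M)
    (hbN : ∀ x ∈ 𝓘.K n ⊓ (cmBorelTriple L 3 v).N, b * x * b⁻¹ ∈ 𝓘.K n)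
    (hbNbar : ∀ x ∈ 𝓘.K n ⊓ 𝓘.Nbar, b⁻¹ * x * b ∈ 𝓘.K n ⊓ 𝓘.Nbar)
    (hbexh : ∀ x ∈ (cmBorelTriple L 3 v).N, ∃ m : ℕ, ∀ m', m ≤ m' → b ^ m' * x * (b ^ m')⁻¹ ∈ 𝓘.K n)
    {R : Finset ↥(unitaryGroupOfForm (conjLocal L (IsCMField.complexConj L) v) (cmLocalForm L 3 v))}
    (hR : IsLeftTransversal (𝓘.K n) (𝓘.K n ⊓ ConjAct.toConjAct b • 𝓘.K n) R) :
    haveI := locallyCompactSpace_cmBorelU L 3 v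
    ∀ (χ : ↥(torusU (conjLocal L (IsCMField.complexConj L) v) (cmLocalForm L 3 v)) →* ℂˣ) (hχ : Continuous fun t => ((χ t : ℂˣ) : ℂ)),
      (cmPrincipalSeries L 3 v χ).smoothTrace ((νG.map (cmDatumLocalCongr L v (1 : GL (Fin 3) (LocalRing L v)) isUnit_one (F0P3cStCharTSDeltaAtLevi.formCongr_one_qsForm L v)).symm : Measure ↥(unitaryGroupOfForm (conjLocal L (IsCMField.complexConj L) v) (cmLocalForm L 3 v))))
        (fun x : ↥(unitaryGroupOfForm (conjLocal L (IsCMField.complexConj L) v) (cmLocalForm L 3 v)) => ((DoubleCoset.doubleCoset b ((𝓘.K n) : Set ↥(unitaryGroupOfForm (conjLocal L (IsCMField.complexConj L) v) (cmLocalForm L 3 v))) ((𝓘.K n) : Set ↥(unitaryGroupOfForm (conjLocal L (IsCMField.complexConj L) v) (cmLocalForm L 3 v)))).indicator fun _ => (1 : ℂ)) ((cmDatumLocalCongr L v (1 : GL (Fin 3) (LocalRing L v)) isUnit_one (F0P3cStCharTSDeltaAtLevi.formCongr_one_qsForm L v)) x)) =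
        if (∀ c ∈ (((𝓘.K n)).comap (cmBorelTriple L 3 v).M.subtype), χ c = 1) then (((((νG.map (cmDatumLocalCongr L v (1 : GL (Fin 3) (LocalRing L v)) isUnit_one (F0P3cStCharTSDeltaAtLevi.formCongr_one_qsForm L v)).symm : Measure ↥(unitaryGroupOfForm (conjLocal L (IsCMField.complexConj L) v) (cmLocalForm L 3 v))))).real ((𝓘.K n) : Set ↥(unitaryGroupOfForm (conjLocal L (IsCMField.complexConj L) v) (cmLocalForm L 3 v))) : ℂ) * (R.card : ℂ) * ((rootDeltaChar (cmBorelTriple L 3 v).P (Subgroup.inclusion (cmBorelTriple L 3 v).M_le (⟨b, hbM⟩ : ↥(cmBorelTriple L 3 v).M)) : ℂˣ) : ℂ)) * (((χ (⟨b, hbM⟩ : ↥(cmBorelTriple L 3 v).M) : ℂˣ) : ℂ) + 1 * ((χ (⟨w₀ * b * w₀⁻¹, weylConj_mem_cmTorus L v w₀ hw₀ (⟨b, hbM⟩ : ↥(cmBorelTriple L 3 v).M)⟩ : ↥(cmBorelTriple L 3 v).M) : ℂˣ) : ℂ)) else 0 := by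
  haveI := locallyCompactSpace_cmBorelU L 3 v
  intro χ hχ
  -- `χ = (χ₁, χ₂)` with continuous components
  obtain ⟨χ₁, χ₂, hpair⟩ := exists_cmTorusCharPair_eq L v χ
  subst hpair
  obtain ⟨h₁, h₂⟩ := F0P2pTorusPairsAndVacuity.continuous_components_of_continuous_torusCharPair (conjLocal L (IsCMField.complexConj L) v)
    (continuous_conjLocal L (IsCMField.complexConj L) v) (conjLocal_conjLocal_cm L v) (cmLocalForm L 3 v) (cmLocalForm_eq_over L 3 v) χ₁ χ₂ hχ
  -- the mapped Haar measure on the matrix carrier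
  haveI hHaar : (((νG.map (cmDatumLocalCongr L v (1 : GL (Fin 3) (LocalRing L v)) isUnit_one (F0P3cStCharTSDeltaAtLevi.formCongr_one_qsForm L v)).symm : Measure ↥(unitaryGroupOfForm (conjLocal L (IsCMField.complexConj L) v) (cmLocalForm L 3 v))))).IsHaarMeasure :=
    MulEquiv.isHaarMeasure_map (H := ↥(unitaryGroupOfForm (conjLocal L (IsCMField.complexConj L) v) (cmLocalForm L 3 v))) νG (cmDatumLocalCongr L v (1 : GL (Fin 3) (LocalRing L v)) isUnit_one (F0P3cStCharTSDeltaAtLevi.formCongr_one_qsForm L v)).symm.toMulEquiv (cmDatumLocalCongr L v (1 : GL (Fin 3) (LocalRing L v)) isUnit_one (F0P3cStCharTSDeltaAtLevi.formCongr_one_qsForm L v)).symm.continuous (cmDatumLocalCongr L v (1 : GL (Fin 3) (LocalRing L v)) isUnit_one (F0P3cStCharTSDeltaAtLevi.formCongr_one_qsForm L v)).continuous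
  haveI : (((νG.map (cmDatumLocalCongr L v (1 : GL (Fin 3) (LocalRing L v)) isUnit_one (F0P3cStCharTSDeltaAtLevi.formCongr_one_qsForm L v)).symm : Measure ↥(unitaryGroupOfForm (conjLocal L (IsCMField.complexConj L) v) (cmLocalForm L 3 v))))).IsMulLeftInvariant := hHaar.toIsMulLeftInvariant
  haveI : IsFiniteMeasureOnCompacts ((νG.map (cmDatumLocalCongr L v (1 : GL (Fin 3) (LocalRing L v)) isUnit_one (F0P3cStCharTSDeltaAtLevi.formCongr_one_qsForm L v)).symm : Measure ↥(unitaryGroupOfForm (conjLocal L (IsCMField.complexConj L) v) (cmLocalForm L 3 v)))) := hHaar.toIsFiniteMeasureOnCompacts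
  have hiff := F0P3cStCharTSShellTracePS.forall_cmTorusCharPair_eq_one_iff_of_weylConj_mem L v (𝓘.K n) w₀ hw₀ hKw χ₁ χ₂
  have main := F0P3cStCharTSShellTracePS.smoothTrace_cmPrincipalSeries_indicator_shell_eq_ite L v hns ((νG.map (cmDatumLocalCongr L v (1 : GL (Fin 3) (LocalRing L v)) isUnit_one (F0P3cStCharTSDeltaAtLevi.formCongr_one_qsForm L v)).symm : Measure ↥(unitaryGroupOfForm (conjLocal L (IsCMField.complexConj L) v) (cmLocalForm L 3 v)))) χ₁ χ₂ h₁ h₂ 𝓘 n hiff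
    hbM hbN hbNbar hbexh hR
  have hfe : (fun x : ↥(unitaryGroupOfForm (conjLocal L (IsCMField.complexConj L) v) (cmLocalForm L 3 v)) => ((DoubleCoset.doubleCoset b ((𝓘.K n) : Set ↥(unitaryGroupOfForm (conjLocal L (IsCMField.complexConj L) v) (cmLocalForm L 3 v))) ((𝓘.K n) : Set ↥(unitaryGroupOfForm (conjLocal L (IsCMField.complexConj L) v) (cmLocalForm L 3 v)))).indicator fun _ => (1 : ℂ)) ((cmDatumLocalCongr L v (1 : GL (Fin 3) (LocalRing L v)) isUnit_one (F0P3cStCharTSDeltaAtLevi.formCongr_one_qsForm L v)) x)) = ((DoubleCoset.doubleCoset b ((𝓘.K n) : Set ↥(unitaryGroupOfForm (conjLocal L (IsCMField.complexConj L) v) (cmLocalForm L 3 v))) ((𝓘.K n) : Set ↥(unitaryGroupOfForm (conjLocal L (IsCMField.complexConj L) v) (cmLocalForm L 3 v)))).indicator fun _ => (1 : ℂ)) :=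
    funext fun x => by rw [cmDatumLocalCongr_one_apply]
  rw [hfe, main]
  have hP : (∀ c ∈ (((𝓘.K n)).comap (cmBorelTriple L 3 v).M.subtype), cmTorusCharPair L v χ₁ χ₂ c = 1) ↔
      (∀ k : ↥(cmBorelTriple L 3 v).M, (k : ↥(unitaryGroupOfForm (conjLocal L (IsCMField.complexConj L) v) (cmLocalForm L 3 v))) ∈ 𝓘.K n → cmTorusCharPair L v χ₁ χ₂ k = 1) :=
    ⟨fun h k hk => h k (Subgroup.mem_comap.2 hk), fun h c hc => h c (Subgroup.mem_comap.1 hc)⟩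
  have hwc : cmWeylTorusCharPair L v χ₁ χ₂ (⟨b, hbM⟩ : ↥(cmBorelTriple L 3 v).M) = cmTorusCharPair L v χ₁ χ₂ (⟨w₀ * b * w₀⁻¹, weylConj_mem_cmTorus L v w₀ hw₀ (⟨b, hbM⟩ : ↥(cmBorelTriple L 3 v).M)⟩ : ↥(cmBorelTriple L 3 v).M) :=
    (cmTorusCharPair_weylConj L v w₀ hw₀ χ₁ χ₂ (⟨b, hbM⟩ : ↥(cmBorelTriple L 3 v).M)).symm
  by_cases hP0 : ∀ k : ↥(cmBorelTriple L 3 v).M, (k : ↥(unitaryGroupOfForm (conjLocal L (IsCMField.complexConj L) v) (cmLocalForm L 3 v))) ∈ 𝓘.K n → cmTorusCharPair L v χ₁ χ₂ k = 1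
  · rw [if_pos hP0, if_pos (hP.2 hP0), hwc, one_mul]
    ring
  · rw [if_neg hP0, if_neg (fun h => hP0 (hP.1 h)), mul_zero]

end Summit.HodgeConjecture.HodgeConjecture.Cruxes.H413.F0P3cStCharTSShellOrbitalG

end
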